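import Summits.HodgeConjecture.HodgeCM.Model.WmInstanceV2
import Summits.HodgeConjecture.HodgeCM.Automorphic.AdelicUnitaryModel_1
import HarnessLib

/-!
# FLOOR-0 P4 — the DEFINITE ARCHIMEDEAN PLACE of the H413 pin (the `(τ, hτ)` binder of the CM-guarded Rallis letter)

Cell hodgecm-mathlib (D-0151), FLOOR 0, crux item H413 = stmt-HodgeConjecture-24833; programme P4, line
`Cruxes/H413/Lines/F0_P4AdmissibleOccursInH1.lean` (ED. 3.2 → 3.3).  Author F0P4-p04 (g3); F0P4-plan (g3) word 2026-08-31T01:44:49Z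
(«L4 critical path»).  `--supports stmt-HodgeConjecture-24833 --as helper`.  DEF-FREE, KERNEL ONLY: theorems over LANDED theorems, no `sorry`,
nothing cited as a fact.

WHY.  F0P4-plan (g3)'s LETTER RULING «CM STRUCTURE BINDERS» (2026-08-31T01:40:06Z, L1–L4) re-letters the Rallis inner-product hypothesis of
S4b ∕ S6 as `Li1992.RallisInnerProductFormulaUnitaryDualPairRankOneContCM`: the ED. 2 telescope plus `[IsTotallyReal F] [IsTotallyComplex E]`
and ONE ANISOTROPIC ARCHIMEDEAN PLACE `(τ : E →+* ℂ) (hτ : (J_V.map τ).PosDef)` — exactly what lets Weil's Siegel–Weil closure run without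
Hasse–Minkowski.  At the H413 pin (`E = L` a CM field, `F = L⁺ = maximalRealSubfield L`, `J_V = Matrix.diagonal (frameD V)` the rational
diagonal frame OF RECORD of the Picard-type hermitian 3-space `V : HermSpace3 L ι₁`) the S4b assembler (F0P4-p01) must hand this pair to `hR`.
This file PRODUCES it from the pin's own sign data:

* `im_apply_frameD`, `apply_frameD_pos_of_ne` — under any `τ` off the place of `ι₁` every frame entry `τ (frameD V i)` is a POSITIVE REAL
  (★ `HodgeCM.Model.frameD_pos_of_ne` = Sylvester read-off of the `HermSpace3` field `posDef_of_ne`; ★ `frameD_real`);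
* **`posDef_diagonal_frameD_map_of_ne`** — `((Matrix.diagonal (frameD V)).map τ).PosDef` for every `τ` with `mk τ ≠ mk ι₁`
  (Mathlib `Matrix.posDef_diagonal_iff` in the `ComplexOrder`);
* **`exists_ne_and_posDef_diagonal_frameD_map`** ∕ **`exists_posDef_diagonal_frameD_map`** (+ the `6 ≤ [L:ℚ]` spellings of the S4b letter) —
  `∃ τ : L →+* ℂ, mk τ ≠ mk ι₁ ∧ ((Matrix.diagonal (frameD V)).map τ).PosDef` as soon as `4 ≤ [L:ℚ]`
  (★ `HodgeCM.exists_infinitePlace_ne`: a CM field of degree `≥ 4` has `≥ 2` complex places);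
* `exists_ne_and_posDef_hm_map` — the same for the Gram matrix `V.Hm` itself (the `HermSpace3` field, recorded for consumers in that currency);
* `isTotallyReal_maximalRealSubfield_pin`, `isTotallyComplex_pin` — the two instance binders of the letter are found by `inferInstance`
  under the pin's `[IsCMField L]` (recorded as theorems so that a consumer can also pass them by name).

HC_CM is proved only modulo the printed citations until rung 0 closes; this file proves nothing about them.

## References
* [Liu2021] Y. Liu, Camb. J. Math. 9 (2021) = arXiv:2102.11518, §4.3 (the Picard-type hermitian space: signature `(2,1)` at `ι₁`, definite elsewhere).
* [Li1992] J.-S. Li, Thm. 2.1 (26) p. 184; [Weil1965] A. Weil, Acta Math. 113, n° 51–52 (the anisotropic archimedean place in the Siegel–Weil closure).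
* Tree (all ★): `HodgeCM/Model/WmInstanceV2` (`frameD`, `frameD_real`, `frameD_pos_of_ne`), `HodgeCM/Automorphic/AdelicUnitaryModel_1`
  (`HodgeCM.exists_infinitePlace_ne`), `HodgeCM/CM/Basic` (`HermSpace3.posDef_of_ne`).
-/

set_option autoImplicit false
set_option linter.dupNamespace false

open NumberField
open scoped ComplexOrder Matrix

namespace Summit.HodgeConjecture.HodgeConjecture.Cruxes.H413.CMPinDefinitePlace

variable {L : HodgeCM.CMField} {ι₁ : L →+* ℂ} (V : HodgeCM.HermSpace3 L ι₁)

/-! ## §1 The frame entries under an embedding off the place of `ι₁` are positive reals -/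

/-- the rational frame entries are REAL under every complex embedding (they are fixed by complex conjugation, ★ `frameD_real`).
[cite: Liu2021, §4.3] -/
theorem im_apply_frameD (τ : (L : Type) →+* ℂ) (i : Fin 3) : (τ (HodgeCM.Model.frameD V i)).im = 0 := by
  have h := IsCMField.complexEmbedding_complexConj (L : Type) τ (HodgeCM.Model.frameD V i)
  rw [HodgeCM.Model.frameD_real V i] at h
  exact Complex.conj_eq_iff_im.mp h.symm

/-- under any `τ` off the place of `ι₁`, every frame entry `τ (frameD V i)` is a POSITIVE element of `ℂ` (in the `ComplexOrder`):
positive real part by ★ `frameD_pos_of_ne` (Sylvester read-off of `HermSpace3.posDef_of_ne`), zero imaginary part by `im_apply_frameD`.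
[cite: Liu2021, §4.3] -/
theorem apply_frameD_pos_of_ne (τ : (L : Type) →+* ℂ) (hτ : InfinitePlace.mk τ ≠ InfinitePlace.mk ι₁) (i : Fin 3) :
    0 < τ (HodgeCM.Model.frameD V i) :=
  Complex.pos_iff.mpr ⟨HodgeCM.Model.frameD_pos_of_ne V τ hτ i, (im_apply_frameD V τ i).symm⟩

/-- `(diagonal d).map τ = diagonal (τ ∘ d)` at the frame of record. -/
theorem diagonal_frameD_map (τ : (L : Type) →+* ℂ) :
    (Matrix.diagonal (HodgeCM.Model.frameD V)).map τ = Matrix.diagonal fun i => τ (HodgeCM.Model.frameD V i) :=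
  Matrix.diagonal_map (map_zero τ)

/-! ## §2 The `(τ, hτ)` binder of `…RankOneContCM` at the pin -/

/-- **THE DIAGONAL FRAME IS POSITIVE DEFINITE UNDER EVERY EMBEDDING OFF THE PLACE OF `ι₁`**:
`((Matrix.diagonal (frameD V)).map τ).PosDef` for `mk τ ≠ mk ι₁`. [cite: Liu2021, §4.3] -/
theorem posDef_diagonal_frameD_map_of_ne (τ : (L : Type) →+* ℂ) (hτ : InfinitePlace.mk τ ≠ InfinitePlace.mk ι₁) :
    ((Matrix.diagonal (HodgeCM.Model.frameD V)).map τ).PosDef := by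
  rw [diagonal_frameD_map]
  exact Matrix.posDef_diagonal_iff.mpr (apply_frameD_pos_of_ne V τ hτ)

/-- **THE `(τ, hτ)` BINDER, WITH THE PLACE CONDITION**: a CM field of degree `≥ 4` has a complex place other than that of `ι₁`
(★ `HodgeCM.exists_infinitePlace_ne`), and there the diagonal frame of `V` is positive definite. [cite: Liu2021, §4.3] -/
theorem exists_ne_and_posDef_diagonal_frameD_map (h4 : 4 ≤ Module.finrank ℚ L) :
    ∃ τ : (L : Type) →+* ℂ, InfinitePlace.mk τ ≠ InfinitePlace.mk ι₁ ∧ ((Matrix.diagonal (HodgeCM.Model.frameD V)).map τ).PosDef := by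
  obtain ⟨τ, hτ⟩ := HodgeCM.exists_infinitePlace_ne L h4 ι₁
  exact ⟨τ, hτ, posDef_diagonal_frameD_map_of_ne V τ hτ⟩

/-- **THE `(τ, hτ)` BINDER of `Li1992.RallisInnerProductFormulaUnitaryDualPairRankOneContCM` AT THE H413 PIN** (F0P4-plan (g3) 2026-08-31T01:44:49Z):
`∃ τ : L →+* ℂ, ((Matrix.diagonal (frameD V)).map τ).PosDef` for every Picard-type hermitian 3-space `V` over a CM field of degree `≥ 4`.
[cite: Liu2021, §4.3] [cite: Li1992, Thm. 2.1 (26) p. 184] -/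
theorem exists_posDef_diagonal_frameD_map (h4 : 4 ≤ Module.finrank ℚ L) :
    ∃ τ : (L : Type) →+* ℂ, ((Matrix.diagonal (HodgeCM.Model.frameD V)).map τ).PosDef := by
  obtain ⟨τ, -, hτ⟩ := exists_ne_and_posDef_diagonal_frameD_map V h4
  exact ⟨τ, hτ⟩

/-- the same at the S4b letter's degree hypothesis `6 ≤ [L:ℚ]` (`StubT3aHolThetaAtAdmissibleLineOfRallisAt`'s binder `h6`), with the place condition.
[cite: Liu2021, §4.3] -/
theorem exists_ne_and_posDef_diagonal_frameD_map_of_six_le (h6 : 6 ≤ Module.finrank ℚ L) :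
    ∃ τ : (L : Type) →+* ℂ, InfinitePlace.mk τ ≠ InfinitePlace.mk ι₁ ∧ ((Matrix.diagonal (HodgeCM.Model.frameD V)).map τ).PosDef :=
  exists_ne_and_posDef_diagonal_frameD_map V (le_trans (by norm_num) h6)

/-- the same at the S4b letter's degree hypothesis `6 ≤ [L:ℚ]`, bare `∃ τ, PosDef` form. [cite: Liu2021, §4.3] -/
theorem exists_posDef_diagonal_frameD_map_of_six_le (h6 : 6 ≤ Module.finrank ℚ L) :
    ∃ τ : (L : Type) →+* ℂ, ((Matrix.diagonal (HodgeCM.Model.frameD V)).map τ).PosDef :=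
  exists_posDef_diagonal_frameD_map V (le_trans (by norm_num) h6)

/-- the Gram-matrix currency: `∃ τ, mk τ ≠ mk ι₁ ∧ (V.Hm.map τ).PosDef` (the `HermSpace3` field `posDef_of_ne` at ★ `exists_infinitePlace_ne`).
[cite: Liu2021, §4.3] -/
theorem exists_ne_and_posDef_hm_map (h4 : 4 ≤ Module.finrank ℚ L) :
    ∃ τ : (L : Type) →+* ℂ, InfinitePlace.mk τ ≠ InfinitePlace.mk ι₁ ∧ (V.Hm.map τ).PosDef := by
  obtain ⟨τ, hτ⟩ := HodgeCM.exists_infinitePlace_ne L h4 ι₁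
  exact ⟨τ, hτ, V.posDef_of_ne τ hτ⟩

/-! ## §3 The two instance binders of the letter at the pin -/

/-- `L⁺ = maximalRealSubfield L` is totally real — found by `inferInstance` (Mathlib). -/
theorem isTotallyReal_maximalRealSubfield_pin : IsTotallyReal ↥(maximalRealSubfield (L : Type)) := inferInstance

/-- a CM field is totally complex — found by `inferInstance` under the pin's `[IsCMField L]`. -/
theorem isTotallyComplex_pin : IsTotallyComplex (L : Type) := inferInstance

end Summit.HodgeConjecture.HodgeConjecture.Cruxes.H413.CMPinDefinitePlace
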